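import Summits.BirchSwinnertonDyer.BirchSwinnertonDyer.Theorems.Rank1ResidualJetSelmerLemmas
import Summits.BirchSwinnertonDyer.BirchSwinnertonDyer.Theorems.Rank1ResidualJetCoreVertexSign
import Literature.NumberTheory.EllipticCurves.HeegnerPointsKolyvaginCebotarevProofs
import HarnessLib

/-!
# Selmer-STRUCTURE bookkeeping of the Jetchev walk: the lozenge identities `hSel` ∕ `hSelT` of the
# kernel `JET.Section6.exists_halfCoreVertex` at the structure level, and the places dividing a
# Kolyvagin conductor (cell `bsd-stepL`, seat `bsd-stepL-tam3-p1`, helper toward item 19109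
# `EulerHalvesAtThree`, registered stub `stub_jetchevMaxHLAtThree`)

HONEST FRAMING. Nothing here proves BSD, J₃ or any divisibility; the registered stub is NOT discharged;
no item closes; 0 classes move (T7); `--supports stmt-BirchSwinnertonDyer-19109` (helper). WHAT THIS
FILE DOES (pure bookkeeping, no arithmetic input). The kernel walk (`exists_halfCoreVertex`, p484455;
joined form `tamagawaExponent_le_m_of_selmerFamilies`, p484791) asks, for the Selmer families
`Sel n s ↦ H_{𝓕(cn)}^{s}` and `Rel n ℓ s ↦ H_{𝓕^λ(cn)}^{s}` on `H¹(K, E[p^k])`, the two identities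
`hSel : H_{𝓕(cn)}^s = H_{𝓕^λ(cn)}^s ∩ loc_λ⁻¹ H¹_f(K_λ)` and
`hSelT : H_{𝓕(cnℓ)}^s = H_{𝓕^λ(cn)}^s ∩ loc_λ⁻¹ H¹_tr(K_λ)` ([J] §4.3 item 3: the structures
`𝓕(cn)`, `𝓕(cnℓ)`, `𝓕^λ(cn)` agree off `λ`, and at `λ` are the Kummer, the transverse, and no
condition). At the STRUCTURE level (bsd-jet pv-2's `Jetchev2008.selmerF W n 𝒯 S =` Kummer structure
made transverse on `S`, `SelmerStructure.relaxedAt`, Mazur–Rubin Def. 2.1.1 `selmerGroup`) these are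
DEFINITIONAL bookkeeping, proved here for any discrete Galois module:
`selmerGroup_eq_relaxedAt_inf_comap` (`H_𝓕 = H_{𝓕^q} ∩ loc_q⁻¹ 𝓕_q`),
`selmerGroup_transverseAt_insert` (`H_{𝓕(S ∪ {q})} = H_{𝓕(S)^q} ∩ loc_q⁻¹ 𝒯_q`, `q ∉ S`),
`selmerGroup_transverseAt_eq_relaxedAt_inf` (`H_{𝓕(S)} = H_{𝓕(S)^q} ∩ loc_q⁻¹ 𝓕_q`, `q ∉ S`), their
sign-part versions (`signPart_inf_right`), and the incidence of places with Kolyvagin conductors: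
`eq_of_natCast_mem_of_span_isPrime` (the place `λ = (ℓ)` of an inert `ℓ` is the only place over `ℓ`),
`placesDividing_mul_eq_insert` (`placesDividing K (mℓ) = insert λ (placesDividing K m)`),
`not_mem_placesDividing_of_not_dvd` (`λ ∉ placesDividing K m` for `ℓ ∤ m`). The instantiation of the
walk at `p = 3` (`…EulerHalvesAtThreeWalk*.lean`) consumes exactly these.
References (locators only; no cited FACT declared): [cite: Jetchev2008, §3.4.1 (p. 816) = arXiv §4.3 item 3; Lemma 3.4 (p. 816)]
[cite: MazurRubin2004, Def. 2.1.1 — cited through Jetchev; not held] [cite: GrossLMS1991, §3 ("its unique prime factor")].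
Design: theorems only; generic discrete Galois module for §1 (`K : Type u`); `K : Type` in §3 (as in `Rank1ResidualJetSelmerLemmas`). Axioms: `propext`,
`Classical.choice`, `Quot.sound`.
-/

set_option autoImplicit false

noncomputable section

open scoped Classical NumberField

namespace Summit.BirchSwinnertonDyer.Rank1Residual.JET.Walk

open WeierstrassCurve IsDedekindDomain NumberField Literature.NumberTheory.EllipticCurves
  Literature.NumberTheory.EllipticCurves.Jetchev2008 Literature.NumberTheory.GaloisRepresentations
  Literature.NumberTheory.GaloisRepresentations.DiscreteGaloisModule

universe u

/-! ### §1 Selmer structures: relaxing and modifying ONE place -/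

section Structures

variable {K : Type u} [Field K] [NumberField K] {M : Type u} [AddCommGroup M] [TopologicalSpace M]
  [DiscreteTopology M] {ρ : DiscreteGaloisModule K M}

/-- **`H_𝓕 = H_{𝓕^q} ∩ loc_q⁻¹(𝓕_q)`**: the Selmer group of `𝓕` is the Selmer group of the
structure relaxed at the finite place `q`, cut back by the local condition of `𝓕` at `q`
(the condition at every other place is unchanged). [cite: Jetchev2008, §3.4.1 (p. 816)] -/
theorem selmerGroup_eq_relaxedAt_inf_comap (𝓕 : SelmerStructure ρ) (q : HeightOneSpectrum (𝓞 K)) :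
    𝓕.selmerGroup =
      (𝓕.relaxedAt {q}).selmerGroup ⊓ (𝓕 (Sum.inr q)).comap (galoisCohomology.localization ρ (Sum.inr q) 1) := by
  ext x
  simp only [AddSubgroup.mem_inf, AddSubgroup.mem_comap, SelmerStructure.mem_selmerGroup_iff]
  constructor
  · intro h
    refine ⟨fun v ↦ ?_, h (Sum.inr q)⟩
    rcases v with w | v
    · simpa [SelmerStructure.relaxedAt] using h (Sum.inl w)
    · by_cases hv : v = q
      · subst hv
        simp [SelmerStructure.relaxedAt]
      · have : v ∉ ({q} : Finset (HeightOneSpectrum (𝓞 K))) := by simpa using hv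
        simpa [SelmerStructure.relaxedAt, SelmerStructure.modify_inr, this] using h (Sum.inr v)
  · rintro ⟨h, hq⟩ v
    rcases v with w | v
    · simpa [SelmerStructure.relaxedAt] using h (Sum.inl w)
    · by_cases hv : v = q
      · subst hv
        exact hq
      · have hv' : v ∉ ({q} : Finset (HeightOneSpectrum (𝓞 K))) := by simpa using hv
        have := h (Sum.inr v)
        simpa [SelmerStructure.relaxedAt, SelmerStructure.modify_inr, hv'] using this

/-- **`H_{𝓕(S ∪ {q})} = H_{𝓕(S)^q} ∩ loc_q⁻¹(𝒯_q)`** for `q ∉ S`: making `𝓕(S)` transverse at one more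
place `q` is relaxing it at `q` and cutting back by the transverse condition `𝒯_q` — the structures
`𝓕(S ∪ {q})` and `𝓕(S)` agree off `q`. (The walk's `hSelT`.) [cite: Jetchev2008, §3.4.1 (p. 816) = arXiv §4.3 item 3] -/
theorem selmerGroup_transverseAt_insert (𝓕 𝒯 : SelmerStructure ρ)
    (S : Finset (HeightOneSpectrum (𝓞 K))) (q : HeightOneSpectrum (𝓞 K)) :
    (𝓕.transverseAt 𝒯 (insert q S)).selmerGroup =
      ((𝓕.transverseAt 𝒯 S).relaxedAt {q}).selmerGroup ⊓
        (𝒯 (Sum.inr q)).comap (galoisCohomology.localization ρ (Sum.inr q) 1) := by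
  rw [selmerGroup_eq_relaxedAt_inf_comap (𝓕.transverseAt 𝒯 (insert q S)) q]
  have hq : 𝓕.transverseAt 𝒯 (insert q S) (Sum.inr q) = 𝒯 (Sum.inr q) := by
    simp [SelmerStructure.transverseAt]
  have hrel : (𝓕.transverseAt 𝒯 (insert q S)).relaxedAt {q} = (𝓕.transverseAt 𝒯 S).relaxedAt {q} := by
    funext v
    rcases v with w | v
    · rfl
    · by_cases hv : v = q
      · subst hv
        simp [SelmerStructure.relaxedAt, SelmerStructure.transverseAt]
      · have hv' : v ∉ ({q} : Finset (HeightOneSpectrum (𝓞 K))) := by simpa using hv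
        by_cases hvS : v ∈ S
        · simp [SelmerStructure.relaxedAt, SelmerStructure.transverseAt, hv', hvS, hv]
        · simp [SelmerStructure.relaxedAt, SelmerStructure.transverseAt, hv', hvS, hv]
  rw [hq, hrel]

/-- **`H_{𝓕(S)} = H_{𝓕(S)^q} ∩ loc_q⁻¹(𝓕_q)`** for `q ∉ S`: at a place not in `S` the structure `𝓕(S)`
carries the unmodified condition `𝓕_q`. (The walk's `hSel`, with `𝓕_q` the Kummer condition.)
[cite: Jetchev2008, §3.4.1 (p. 816) = arXiv §4.3 item 3] -/
theorem selmerGroup_transverseAt_eq_relaxedAt_inf (𝓕 𝒯 : SelmerStructure ρ)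
    {S : Finset (HeightOneSpectrum (𝓞 K))} {q : HeightOneSpectrum (𝓞 K)} (hq : q ∉ S) :
    (𝓕.transverseAt 𝒯 S).selmerGroup =
      ((𝓕.transverseAt 𝒯 S).relaxedAt {q}).selmerGroup ⊓
        (𝓕 (Sum.inr q)).comap (galoisCohomology.localization ρ (Sum.inr q) 1) := by
  rw [selmerGroup_eq_relaxedAt_inf_comap (𝓕.transverseAt 𝒯 S) q]
  have : 𝓕.transverseAt 𝒯 S (Sum.inr q) = 𝓕 (Sum.inr q) := by
    simp [SelmerStructure.transverseAt, hq]
  rw [this]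

/-- Relaxing enlarges the Selmer group: `H_𝓕 ≤ H_{𝓕^a}`. [cite: Jetchev2008, Lemma 3.4 (p. 816)] -/
theorem selmerGroup_le_relaxedAt (𝓕 : SelmerStructure ρ) (a : Finset (HeightOneSpectrum (𝓞 K))) :
    𝓕.selmerGroup ≤ (𝓕.relaxedAt a).selmerGroup := by
  intro x hx
  rw [SelmerStructure.mem_selmerGroup_iff] at hx ⊢
  intro v
  rcases v with w | v
  · simpa [SelmerStructure.relaxedAt] using hx (Sum.inl w)
  · by_cases hv : v ∈ a
    · simp [SelmerStructure.relaxedAt, hv]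
    · simpa [SelmerStructure.relaxedAt, SelmerStructure.modify_inr, hv] using hx (Sum.inr v)

end Structures

/-! ### §2 Sign parts commute with cutting back -/

section Signs

variable (W : WeierstrassCurve ℚ) (K : Type) [Field K] [NumberField K]

/-- `(A ∩ B)^{e} = A^{e} ∩ B`: the `e`-eigen-part of an intersection is the eigen-part of the first
factor cut back by the second. Elementary. [cite: Jetchev2008, Lemma 3.4 (p. 816)] -/
theorem signPart_inf_right (τ : K ≃ₐ[ℚ] K) (n e : ℤ)
    (A B : AddSubgroup (galoisCohomology ((W.baseChange K).torsionGaloisModule n) 1)) :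
    signPart W K τ n e (A ⊓ B) = signPart W K τ n e A ⊓ B := by
  simp only [signPart]
  exact inf_right_comm A B _

/-- `A^{e} ≤ (⊤)^{e}`: every eigen-part lies in the eigen-subgroup of all of `H¹(K, E[n])` (the walk's
`hSelGs`). Elementary. [cite: Jetchev2008, §3.2.2 (p. 815)] -/
theorem signPart_le_signPart_top (τ : K ≃ₐ[ℚ] K) (n e : ℤ)
    (A : AddSubgroup (galoisCohomology ((W.baseChange K).torsionGaloisModule n) 1)) :
    signPart W K τ n e A ≤ signPart W K τ n e ⊤ :=
  signPart_mono W K τ n e le_top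

/-- Membership in `(⊤)^{e}` is the eigen-equation `τ x = e • x`. [cite: Jetchev2008, §3.2.2 (p. 815)] -/
theorem mem_signPart_top_iff (τ : K ≃ₐ[ℚ] K) (n e : ℤ)
    (x : galoisCohomology ((W.baseChange K).torsionGaloisModule n) 1) :
    x ∈ signPart W K τ n e ⊤ ↔ conjAct W τ n x = e • x := by
  rw [mem_signPart_iff]
  simp

end Signs

/-! ### §3 The places of `K` dividing a Kolyvagin conductor -/

section Places

variable {K : Type} [Field K] [NumberField K]

/-- **An inert rational prime has ONE place above it**: if `(ℓ)` is a prime ideal of `𝓞_K` and the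
finite place `v` contains `ℓ`, then every finite place containing `ℓ` equals `v` (a non-zero prime
of a Dedekind domain is maximal). [cite: GrossLMS1991, §3 ("we let λ denote its unique prime factor")] -/
theorem eq_of_natCast_mem_of_span_isPrime {ℓ : ℕ} (hℓ : ℓ ≠ 0)
    (hprime : (Ideal.span {(ℓ : 𝓞 K)}).IsPrime) {v w : HeightOneSpectrum (𝓞 K)}
    (hv : (ℓ : 𝓞 K) ∈ v.asIdeal) (hw : (ℓ : 𝓞 K) ∈ w.asIdeal) : w = v := by
  have hbot : Ideal.span {(ℓ : 𝓞 K)} ≠ ⊥ := by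
    rw [Ne, Ideal.span_singleton_eq_bot]
    exact_mod_cast hℓ
  have hmax : (Ideal.span {(ℓ : 𝓞 K)}).IsMaximal := Ideal.IsPrime.isMaximal hprime hbot
  have hv' : v.asIdeal = Ideal.span {(ℓ : 𝓞 K)} :=
    (hmax.eq_of_le v.isPrime.ne_top ((Ideal.span_singleton_le_iff_mem _).mpr hv)).symm
  have hw' : w.asIdeal = Ideal.span {(ℓ : 𝓞 K)} :=
    (hmax.eq_of_le w.isPrime.ne_top ((Ideal.span_singleton_le_iff_mem _).mpr hw)).symm
  exact HeightOneSpectrum.ext (hw'.trans hv'.symm)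

/-- **`placesDividing K ℓ = {λ}`** for an inert prime `ℓ` with place `λ ∋ ℓ`.
[cite: Jetchev2008, §3.4.1 (p. 816)] [cite: GrossLMS1991, §3] -/
theorem placesDividing_eq_singleton {ℓ : ℕ} (hℓ : ℓ.Prime)
    (hprime : (Ideal.span {(ℓ : 𝓞 K)}).IsPrime) {v : HeightOneSpectrum (𝓞 K)}
    (hv : (ℓ : 𝓞 K) ∈ v.asIdeal) : placesDividing K ℓ = {v} := by
  ext w
  rw [Finset.mem_singleton, SelmerVocabulary.mem_placesDividing_iff_natCast_mem hℓ.ne_zero]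
  exact ⟨fun hw ↦ eq_of_natCast_mem_of_span_isPrime hℓ.ne_zero hprime hv hw, fun h ↦ h ▸ hv⟩

/-- **`placesDividing K (m·ℓ) = insert λ (placesDividing K m)`** for `m ≠ 0` and an inert prime `ℓ`
with place `λ`: a place divides `mℓ` iff it divides `m` or is `λ`. [cite: Jetchev2008, §3.4.1 (p. 816)] -/
theorem placesDividing_mul_eq_insert {m ℓ : ℕ} (hm : m ≠ 0) (hℓ : ℓ.Prime)
    (hprime : (Ideal.span {(ℓ : 𝓞 K)}).IsPrime) {v : HeightOneSpectrum (𝓞 K)}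
    (hv : (ℓ : 𝓞 K) ∈ v.asIdeal) :
    placesDividing K (m * ℓ) = insert v (placesDividing K m) := by
  have hmℓ : m * ℓ ≠ 0 := mul_ne_zero hm hℓ.ne_zero
  ext w
  rw [Finset.mem_insert, SelmerVocabulary.mem_placesDividing_iff_natCast_mem hmℓ,
    SelmerVocabulary.mem_placesDividing_iff_natCast_mem hm]
  constructor
  · intro h
    rcases natCast_mul_mem_asIdeal h with h1 | h2
    · exact Or.inr h1
    · exact Or.inl (eq_of_natCast_mem_of_span_isPrime hℓ.ne_zero hprime hv h2)
  · rintro (rfl | h)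
    · rw [Nat.cast_mul]
      exact w.asIdeal.mul_mem_left _ hv
    · rw [Nat.cast_mul]
      exact w.asIdeal.mul_mem_right _ h

/-- **`λ ∉ placesDividing K m` when `ℓ ∤ m`** (`ℓ` an inert prime with place `λ`): a prime factor of
`m` lying in `λ` would be a rational prime `≠ ℓ` in `λ ∋ ℓ`. [cite: Jetchev2008, §3.4.1 (p. 816)]
[cite: GrossLMS1991, §3 (3.1)] -/
theorem not_mem_placesDividing_of_not_dvd {m ℓ : ℕ} (hℓ : ℓ.Prime)
    {v : HeightOneSpectrum (𝓞 K)} (hv : (ℓ : 𝓞 K) ∈ v.asIdeal) (hndvd : ¬ ℓ ∣ m) :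
    v ∉ placesDividing K m := by
  intro hmem
  rcases Nat.eq_zero_or_pos m with rfl | hmpos
  · exact hndvd (dvd_zero ℓ)
  have hm : m ≠ 0 := hmpos.ne'
  rw [SelmerVocabulary.mem_placesDividing_iff_natCast_mem hm,
    SelmerVocabulary.natCast_mem_iff_exists_primeFactor_mem hm] at hmem
  obtain ⟨q, hq, hqv⟩ := hmem
  have hqP : q.Prime := Nat.prime_of_mem_primeFactors hq
  have hne : ℓ ≠ q := fun h ↦ hndvd (h ▸ Nat.dvd_of_mem_primeFactors hq)
  exact not_natCast_mem_of_prime_ne hℓ hqP hne v hv hqv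

/-- The incidence in the `∀ v, ℓ ∈ v → …` form used by the localisation lemmas: under inertness a
statement at every place over `ℓ` is the statement at `λ`. [cite: GrossLMS1991, §3] -/
theorem forall_natCast_mem_iff {ℓ : ℕ} (hℓ : ℓ ≠ 0)
    (hprime : (Ideal.span {(ℓ : 𝓞 K)}).IsPrime) {v : HeightOneSpectrum (𝓞 K)}
    (hv : (ℓ : 𝓞 K) ∈ v.asIdeal) (P : HeightOneSpectrum (𝓞 K) → Prop) :
    (∀ w : HeightOneSpectrum (𝓞 K), (ℓ : 𝓞 K) ∈ w.asIdeal → P w) ↔ P v :=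
  ⟨fun h ↦ h v hv, fun h w hw ↦ by
    obtain rfl : w = v := eq_of_natCast_mem_of_span_isPrime hℓ hprime hv hw
    exact h⟩

end Places

end Summit.BirchSwinnertonDyer.Rank1Residual.JET.Walk

end
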